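/-
Copyright (c) 2026 the pub-hodgecm-mathlib formalisation cell (harness21).  Prover seat hodgecm-mathlib-LH4-p19 (g2), req620 Track A «(D-RAM) FOUR-FRAME» squad
(STAGE-1b, row (2) of the piece `f_{T₊}`, the (β₂) road (R-36) «PURE-CELL LEDGER»; the THREE-WAY count socket of a cone cell `(j, b)` — LH4-p15 (g2) 00:46Z ask: populated members may be unlabelled),
2026-09-05.
-/
import Summits.HodgeConjecture.HodgeConjecture.Theorems.F0P3cDyRamDiagonalCellBalancedCount   -- ★ p863197 (this seat, K6c): brings ★ p862250 `card_filter_comp_eq_mul_of_fibre_const`, the vocabulary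
import Summits.HodgeConjecture.HodgeConjecture.Theorems.F0P3cDyRamConeCellFaceTubeAbove      -- ★ (LH4-p16 (g0)) HEAD-hi `finsum_levelSetDep_inter_weight_eq_iff_of_le` (`d ≤ b`)
import HarnessLib

/-!
# Crux `H413`, line LH4 «(D-RAM) FOUR-FRAME» — STAGE-1b, row (2), the (β₂) road (R-36) — «THE THREE-WAY COUNT SOCKET OF ANY CONE CELL»: as ★ `…ConeCellCountSocket`, but the two
# literals are read on a LABELLED sub-family `NX` of digits (populated members off `NX` lie in NEITHER literal — the terminal line, LH4-p15 (g2))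

Cell `hodgecm-mathlib` (D-0151), FLOOR 0, crux item H413 = `stmt-HodgeConjecture-24833`, route of record `HCCMUnconditional`; squad F0∕P3c∕LH4; lane
`--supports stmt-HodgeConjecture-24833 --as helper` (count-neutral; pays NO tier-0 row).  THEOREMS ONLY (no `def`, no instance, no notation, no `sorry`, default heartbeats);
★-only imports; states NO law; (β₂) stays a HYPOTHESIS.  FRAME = ★ `…ConeCellFaceTubeAbove`'s VERBATIM (E-side wild datum, line model, weight letter `hf`, `u : E`, `1 ≤ b`, `d ≤ b`,
`IsOrd ρ α (jEϖ^j) lam`) + ONE cell letter `hcell : levelSetDep(j, b; μ) = levelSet(j, b)` (★ `levelSetDep_eq_levelSet_of_add_le` below the terminal line, ★ `levelSetDep_diag_eq_levelSet`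
on the diagonal) + the SEVEN currency-free fibration letters of ★ p863197 §1 (class `CLS : M → Prop`, coordinate `Vf : M → M`, digit system `Rd`, literal `LIT`, label `ψ`: (hI)
generator independence, (hV) preimages, (hLit) literal digits, (hψ) label constant on digit classes, (hF) equal literal fibres, (hfin), (hbase) digit balance) + the THREE reads of
★ p863270 ((hP) populatedness ⟺ (CLS ↔ ε); (hL₁)(hL₂) the literals on populated lattices as `∃ V̂, jE V̂ = Vf x₀ ∧ ψ V̂` ∕ `¬ψ V̂`).

WHY (β₂ WORD #22 `hL_ray`∕`hU_ray`; LH7-p09 (g2) BETA2-OFF-RESIDUAL v1 §4 (2); LH4-p16 (g2) MECH-K3 ∕ ★ K5-C).  This seat's D-cell chain (★ K1–K7c) runs in the diagonal coordinates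
`T = Tr_ρ ŵ`, `V = Tr_ρ(θ₀ŵ)∕T` (`|h·x₀Θx₀| = 1` ONLY at `j = b`); on a tower `b < j` the natural currency is LH4-p16's `(t, κ̂)` (★ p862871, ★ K5-C (1)–(9)), on the lower line
LH7-p09's ray letters (★ p863440∕p863533).  What is currency-FREE is the counting: ★ p863197 §1 and ★ HEAD-hi.  ★ `…ConeCellCountSocket` packages that for ANY cell with TWO-way reads; THIS FILE is the THREE-way form asked by LH4-p15 (g2) (00:46Z) for the terminal line: the consumer
supplies `CLS`, `Vf`, the digit data and the reads in ITS currency (p16: `CLS := ω(t) = p`, `Vf := κ̂`-digit, (hI) ★ `v_map_sub_mul_le_of_orderUnit`, (hF) ★ `…RowCellFibreTransport`;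
LH7-p09: (hL₁)(hL₂) ★ FILE 11∕13) and gets `X(j, b) = 0` in ‹OFF›∕‹beta2ConesB› bytes.
* §1 `ncard_eq_ncard_of_digit_fibration₂` (two labels), §2 HEAD `cellDiff_eq_zero_of_fibration_reads₃` (three-way reads: `NX ∧ ψ`, `NX ∧ ¬ψ`).
HONEST LABEL.  Count-neutral bookkeeping; every mathematical input is a HYPOTHESIS; nothing printed is asserted; no census law is stated; `HC_CM` is proved only modulo the 7 printed
citations (2 remaining named inputs: hLiu418 = `stmt-HodgeConjecture-24832`, h413 = `stmt-HodgeConjecture-24833`) until rung 0 closes.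
## References
* [Kottwitz1986BaseChangeUnits] R. E. Kottwitz, *Base change for unit elements of Hecke algebras*, Compositio Math. 60 (1986): §1 pp. 240–241 (fixed-lattice counts).
* [LabesseLanglands1979] J.-P. Labesse, R. P. Langlands, *L-indistinguishability for SL(2)*, Canad. J. Math. 31 (1979): §2 (2.2) p. 9 (κ-signed counts).
* [Rogawski1990] J. D. Rogawski, *Automorphic Representations of Unitary Groups in Three Variables*, Ann. of Math. Stud. 123 (1990): §4.9 Prop. 4.9.1 (b) p. 55.
* [Jacobowitz1962] R. Jacobowitz, *Hermitian forms over local fields*, Amer. J. Math. 84 (1962): §4.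
-/

set_option autoImplicit false

noncomputable section

namespace Summit.HodgeConjecture.HodgeConjecture.Cruxes.H413.F0P3cDyRamConeCellCountSocketThree

open scoped Valued WithZero Matrix MatrixGroups Classical
open WithZero Finset
open Literature.NumberTheory.Automorphic Literature.NumberTheory.Automorphic.HermitianLattice Literature.NumberTheory.Automorphic.UnitaryLatticeTree
open Literature.NumberTheory.Automorphic.UnitaryThreeFourFrame (IsRamifiedQuadraticDatum)
open Summit.HodgeConjecture.HodgeConjecture.Cruxes.H413.F0P3cDyRamToricCensusDefs
open Summit.HodgeConjecture.HodgeConjecture.Cruxes.H413.F0P3cDyRamCellBalanceOfFibreHalving (card_filter_comp_eq_mul_of_fibre_const)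
open Summit.HodgeConjecture.HodgeConjecture.Cruxes.H413.F0P3cDyRamConeCellFaceTubeAbove (finsum_levelSetDep_inter_weight_eq_iff_of_le)

variable {E M : Type} [Field E] [Valued E ℤᵐ⁰] [Field M] [Valued M ℤᵐ⁰] {σ : E →+* E} {ρ Θ : M →+* M} {α : M}

/-! ## §1 The abstract count with two digit labels -/

/-- **BALANCE OF TWO DIGIT-DETERMINED LABELS ON A CLASS OF THE CELL (abstract, two-predicate form of ★ p863197 §1).**  Same letters as ★ `ncard_eq_ncard_of_digit_fibration`
(generator data `GEN`, class `CLS`, coordinate `Vf`, `jE` isometric, digit system `R_d` modulo `r`, literal `LIT`, (hI) generator independence, (hP) preimages, (hL) literal digits,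
(hF) equal literal fibres, finiteness) with TWO labels `ψ₁, ψ₂` constant on digit classes and balanced on the literal digits (`#{LIT ∧ ψ₁} = #{LIT ∧ ψ₂}`); THEN
`#{Λ ∣ ∃ x₀, GEN ∧ (CLS ↔ ε) ∧ ∃ V̂, jE V̂ = Vf x₀ ∧ ψ₁ V̂} = #{… ∧ ψ₂ V̂}` (★ p862250 `card_filter_comp_eq_mul_of_fibre_const` twice).  The three-way reads of a cell whose populated
members may be UNLABELLED (LH4-p15 (g2), the terminal line) are the case `ψ₁ := NX ∧ ψ`, `ψ₂ := NX ∧ ¬ψ`. [cite: Kottwitz1986BaseChangeUnits, §1 pp. 240–241] [cite: LabesseLanglands1979, §2 (2.2) p. 9] -/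
theorem ncard_eq_ncard_of_digit_fibration₂ {X : Type} (GEN : X → M → Prop) (CLS : M → Prop) (Vf : M → M) (ε : Prop)
    (jE : E →+* M) (hjiso : ∀ a, Valued.v (jE a) = Valued.v a) (r : ℤᵐ⁰)
    (Rd : Finset E) (hRd2 : ∀ V : E, σ V = V → Valued.v V ≤ 1 → ∃ V₀ ∈ Rd, Valued.v (V - V₀) ≤ r)
    (hRd3 : ∀ V ∈ Rd, ∀ V' ∈ Rd, Valued.v (V - V') ≤ r → V = V')
    (LIT ψ₁ ψ₂ : E → Prop) [DecidablePred LIT] [DecidablePred ψ₁] [DecidablePred ψ₂]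
    (hI : ∀ (Λ : X) (x₀ x₀' : M), GEN Λ x₀ → GEN Λ x₀' → (CLS x₀ ↔ CLS x₀') ∧ Valued.v (Vf x₀' - Vf x₀) ≤ r)
    (hP : ∀ (Λ : X) (x₀ : M), GEN Λ x₀ → ∃ Ve : E, jE Ve = Vf x₀ ∧ σ Ve = Ve ∧ Valued.v Ve ≤ 1)
    (hL : ∀ (Λ : X) (x₀ : M) (V₀ : E), GEN Λ x₀ → V₀ ∈ Rd → Valued.v (Vf x₀ - jE V₀) ≤ r → LIT V₀)
    (hψ₁ : ∀ Ve V₀ : E, σ Ve = Ve → Valued.v Ve ≤ 1 → V₀ ∈ Rd → Valued.v (Ve - V₀) ≤ r → (ψ₁ Ve ↔ ψ₁ V₀))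
    (hψ₂ : ∀ Ve V₀ : E, σ Ve = Ve → Valued.v Ve ≤ 1 → V₀ ∈ Rd → Valued.v (Ve - V₀) ≤ r → (ψ₂ Ve ↔ ψ₂ V₀))
    (hF : ∀ y ∈ Rd.filter LIT, ∀ y' ∈ Rd.filter LIT,
      {Λ : X | ∃ x₀, GEN Λ x₀ ∧ (CLS x₀ ↔ ε) ∧ Valued.v (Vf x₀ - jE y) ≤ r}.ncard =
        {Λ : X | ∃ x₀, GEN Λ x₀ ∧ (CLS x₀ ↔ ε) ∧ Valued.v (Vf x₀ - jE y') ≤ r}.ncard)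
    (hfin : {Λ : X | ∃ x₀, GEN Λ x₀}.Finite)
    (hbase : ((Rd.filter LIT).filter ψ₁).card = ((Rd.filter LIT).filter ψ₂).card) :
    {Λ : X | ∃ x₀, GEN Λ x₀ ∧ (CLS x₀ ↔ ε) ∧ ∃ Ve : E, jE Ve = Vf x₀ ∧ ψ₁ Ve}.ncard =
      {Λ : X | ∃ x₀, GEN Λ x₀ ∧ (CLS x₀ ↔ ε) ∧ ∃ Ve : E, jE Ve = Vf x₀ ∧ ψ₂ Ve}.ncard := by
  set B : Finset E := Rd.filter LIT with hB
  -- the digit of a lattice: a literal digit within `r` of a coordinate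
  have hdig : ∀ Λ : X, (∃ x₀, GEN Λ x₀) → ∃ V₀ ∈ B, ∃ x₀, GEN Λ x₀ ∧ Valued.v (Vf x₀ - jE V₀) ≤ r := by
    rintro Λ ⟨x₀, hG⟩
    obtain ⟨Ve, hjVe, hσVe, hVe1⟩ := hP Λ x₀ hG
    obtain ⟨V₀, hV₀R, hnear⟩ := hRd2 Ve hσVe hVe1
    have hnearM : Valued.v (Vf x₀ - jE V₀) ≤ r := by rw [← hjVe, ← map_sub, hjiso]; exact hnear
    exact ⟨V₀, mem_filter.2 ⟨hV₀R, hL Λ x₀ V₀ hG hV₀R hnearM⟩, x₀, hG, hnearM⟩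
  choose! π hπB hπnear using hdig
  -- the digit is unique: for any generator, `|Vf x₀ − jE V₀| ≤ r ↔ π Λ = V₀`
  have hπuniq : ∀ (Λ : X) (x₀ : M) (V₀ : E), GEN Λ x₀ → V₀ ∈ Rd → (Valued.v (Vf x₀ - jE V₀) ≤ r ↔ π Λ = V₀) := by
    intro Λ x₀ V₀ hG hV₀R
    obtain ⟨x₁, hG₁, h₁⟩ := hπnear Λ ⟨x₀, hG⟩
    have hI₁ : Valued.v (Vf x₁ - Vf x₀) ≤ r := (hI Λ x₀ x₁ hG hG₁).2
    have hπR : π Λ ∈ Rd := (mem_filter.1 (hπB Λ ⟨x₀, hG⟩)).1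
    constructor
    · intro h0
      refine hRd3 _ hπR _ hV₀R ?_
      rw [← hjiso, map_sub]
      have e : jE (π Λ) - jE V₀ = (Vf x₀ - jE V₀) - (Vf x₁ - jE (π Λ)) + (Vf x₁ - Vf x₀) := by ring
      rw [e]
      exact (Valuation.map_add _ _ _).trans (max_le ((Valuation.map_sub _ _ _).trans (max_le h0 h₁)) hI₁)
    · rintro rfl
      have e : Vf x₀ - jE (π Λ) = (Vf x₁ - jE (π Λ)) - (Vf x₁ - Vf x₀) := by ring
      rw [e]
      exact (Valuation.map_sub _ _ _).trans (max_le h₁ hI₁)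
  -- the populated class `S` as a finite set
  set S : Finset X := hfin.toFinset.filter (fun Λ => ∃ x₀, GEN Λ x₀ ∧ (CLS x₀ ↔ ε)) with hS
  have hmemS : ∀ Λ, Λ ∈ S ↔ ∃ x₀, GEN Λ x₀ ∧ (CLS x₀ ↔ ε) := by
    intro Λ
    rw [hS, mem_filter, Set.Finite.mem_toFinset, Set.mem_setOf_eq]
    exact ⟨fun hh => hh.2, fun hh => ⟨(by obtain ⟨x₀, hG, -⟩ := hh; exact ⟨x₀, hG⟩), hh⟩⟩
  have hSB : ∀ Λ ∈ S, π Λ ∈ B := fun Λ hΛ => by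
    obtain ⟨x₀, hG, -⟩ := (hmemS Λ).1 hΛ
    exact hπB Λ ⟨x₀, hG⟩
  -- the fibres of `π` over the digits are the `∃`-fibres
  have hcardfib : ∀ y ∈ Rd, (S.filter fun Λ => π Λ = y).card = {Λ : X | ∃ x₀, GEN Λ x₀ ∧ (CLS x₀ ↔ ε) ∧ Valued.v (Vf x₀ - jE y) ≤ r}.ncard := by
    intro y hy
    have hset : ((S.filter fun Λ => π Λ = y) : Set X) = {Λ : X | ∃ x₀, GEN Λ x₀ ∧ (CLS x₀ ↔ ε) ∧ Valued.v (Vf x₀ - jE y) ≤ r} := by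
      ext Λ
      simp only [coe_filter, Set.mem_setOf_eq, hmemS]
      constructor
      · rintro ⟨⟨x₀, hG, hC⟩, hπ⟩
        exact ⟨x₀, hG, hC, (hπuniq Λ x₀ y hG hy).2 hπ⟩
      · rintro ⟨x₀, hG, hC, hn⟩
        exact ⟨⟨x₀, hG, hC⟩, (hπuniq Λ x₀ y hG hy).1 hn⟩
    rw [← hset, Set.ncard_coe_finset]
  -- the fibres over the literal digits have one size `k`
  obtain ⟨k, hk⟩ : ∃ k : ℕ, ∀ y ∈ B, (S.filter fun Λ => π Λ = y).card = k := by
    by_cases hBne : B.Nonempty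
    · obtain ⟨y₀, hy₀⟩ := hBne
      refine ⟨(S.filter fun Λ => π Λ = y₀).card, fun y hy => ?_⟩
      rw [hcardfib y (mem_filter.1 hy).1, hcardfib y₀ (mem_filter.1 hy₀).1]
      exact hF y hy y₀ hy₀
    · exact ⟨0, fun y hy => absurd ⟨y, hy⟩ hBne⟩
  -- the abstract balance on `S`
  have hbal : (S.filter fun Λ => ψ₁ (π Λ)).card = (S.filter fun Λ => ψ₂ (π Λ)).card := by
    rw [card_filter_comp_eq_mul_of_fibre_const S π B hSB k hk ψ₁, card_filter_comp_eq_mul_of_fibre_const S π B hSB k hk ψ₂, hbase]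
  -- identify the two sides: the label of a lattice is the label of its digit
  have hside : ∀ (φ : E → Prop) [DecidablePred φ], (∀ Ve V₀ : E, σ Ve = Ve → Valued.v Ve ≤ 1 → V₀ ∈ Rd → Valued.v (Ve - V₀) ≤ r → (φ Ve ↔ φ V₀)) →
      ((S.filter fun Λ => φ (π Λ)) : Set X) = {Λ : X | ∃ x₀, GEN Λ x₀ ∧ (CLS x₀ ↔ ε) ∧ ∃ Ve : E, jE Ve = Vf x₀ ∧ φ Ve} := by
    intro φ _ hφ
    ext Λ
    simp only [coe_filter, Set.mem_setOf_eq, hmemS]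
    constructor
    · rintro ⟨⟨x₀, hG, hC⟩, hφπ⟩
      obtain ⟨Ve, hjVe, hσVe, hVe1⟩ := hP Λ x₀ hG
      have hπR : π Λ ∈ Rd := (mem_filter.1 (hπB Λ ⟨x₀, hG⟩)).1
      have hnear : Valued.v (Ve - π Λ) ≤ r := by
        rw [← hjiso, map_sub, hjVe]; exact (hπuniq Λ x₀ (π Λ) hG hπR).2 rfl
      exact ⟨x₀, hG, hC, Ve, hjVe, (hφ Ve (π Λ) hσVe hVe1 hπR hnear).2 hφπ⟩
    · rintro ⟨x₀, hG, hC, Ve, hjVe, hφVe⟩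
      have hπR : π Λ ∈ Rd := (mem_filter.1 (hπB Λ ⟨x₀, hG⟩)).1
      obtain ⟨Ve', hjVe', hσVe, hVe1⟩ := hP Λ x₀ hG
      have hVV : Ve' = Ve := jE.injective (by rw [hjVe', hjVe])
      rw [hVV] at hσVe hVe1
      have hnear : Valued.v (Ve - π Λ) ≤ r := by
        rw [← hjiso, map_sub, hjVe]; exact (hπuniq Λ x₀ (π Λ) hG hπR).2 rfl
      exact ⟨⟨x₀, hG, hC⟩, (hφ Ve (π Λ) hσVe hVe1 hπR hnear).1 hφVe⟩
  rw [← hside ψ₁ hψ₁, ← hside ψ₂ hψ₂, Set.ncard_coe_finset, Set.ncard_coe_finset]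
  exact hbal

/-! ## §2 HEAD — the three-way count socket of any cone cell -/

/-- **HEAD — «THE THREE-WAY COUNT SOCKET OF ANY CONE CELL».**  Frame of ★ `…ConeCellFaceTubeAbove` VERBATIM (`σ hσ hvσ ϖ hϖ d t hD h2v H₂ hH₂σ hW hhW hhWσ jE hρρ hvρ hα hα1 hint hΘΘ hΘρ hvΘ hΘj
hjv hjfix hjpow hϖmax φ hφs hφi hφo γ₂ lam h hφγ hlam hΘh hh hform (u : E) b hb (hdb : d ≤ b) j (hlamj) f hf`) + `hjiso` + `hcell : levelSetDep(j, b; lam − jE u) = levelSet(j, b)` +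
`hfin : (levelSet … j b).Finite` + the seven letters of ★ p863197 §1 for the cell's generator data (`CLS Vf ε r Rd hRd2 hRd3 LIT ψ hI hV hLit hψ hF hbase`) + a «labelled» digit predicate `NX` and a label `ψ`, both constant on digit classes and with `ψ` balanced on `LIT ∧ NX`; two
cell predicates `P₁ Q₁` read THREE-WAY: (hP) populatedness, (hL₁) `P₁ Λ ↔ ∃ V̂, jE V̂ = Vf x₀ ∧ NX V̂ ∧ ψ V̂`, (hL₂) `Q₁ Λ ↔ ∃ V̂, jE V̂ = Vf x₀ ∧ NX V̂ ∧ ¬ψ V̂`.  THEN `((Σᶠ_{Λ ∈ cell ∩ {P₁}} f b j Λ : ℕ) : ℤ) − ((Σᶠ_{Λ ∈ cell ∩ {Q₁}} f b j Λ : ℕ) : ℤ) = 0`, `cell = levelSetDep ρ Θ α (jE ϖ) h j b (lam − jE u)`.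
[cite: Kottwitz1986BaseChangeUnits, §1 pp. 240–241] [cite: LabesseLanglands1979, §2 (2.2) p. 9] [cite: Rogawski1990, §4.9 Prop. 4.9.1 (b) p. 55] -/
theorem cellDiff_eq_zero_of_fibration_reads₃ [CompleteSpace E] [IsDiscreteValuationRing 𝒪[E]] [Finite 𝓀[E]]
    (σ : E →+* E) (hσ : ∀ a, σ (σ a) = a) (hvσ : ∀ a, Valued.v (σ a) = Valued.v a)
    {ϖ : E} (hϖ : Valued.v ϖ = WithZero.exp (-1 : ℤ)) {d t : ℕ} (hD : IsRamifiedQuadraticDatum σ ϖ d t) (h2v : Valued.v (2 : E) < 1)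
    {H₂ : Matrix (Fin 2) (Fin 2) E} (hH₂σ : (H₂.map σ)ᵀ = H₂) {hW : E} (hhW : Valued.v hW = 1) (hhWσ : σ hW = hW) (jE : E →+* M)
    (hρρ : ∀ x, ρ (ρ x) = x) (hvρ : ∀ x, Valued.v (ρ x) = Valued.v x) (hα : ρ α ≠ α) (hα1 : Valued.v α ≤ 1)
    (hint : ∀ z : M, Valued.v z ≤ 1 → Valued.v ((z - ρ z) / (α - ρ α)) ≤ 1)
    (hΘΘ : ∀ x, Θ (Θ x) = x) (hΘρ : ∀ x, Θ (ρ x) = ρ (Θ x)) (hvΘ : ∀ x, Valued.v (Θ x) = Valued.v x) (hΘj : ∀ x, Θ (jE x) = jE (σ x))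
    (hjv : ∀ c, Valued.v (jE c) ≤ 1 ↔ Valued.v c ≤ 1) (hjfix : ∀ z, ρ z = z ↔ ∃ c, jE c = z)
    (hjpow : ∀ (t : E) (n : ℤ), Valued.v (jE t) = Valued.v (jE ϖ) ^ n ↔ Valued.v t = Valued.v ϖ ^ n)
    (hϖmax : ∀ t : M, ρ t = t → Valued.v t < 1 → Valued.v t ≤ Valued.v (jE ϖ))
    (φ : (Fin 2 → E) →+ M) (hφs : ∀ (c : E) (x : Fin 2 → E), φ (c • x) = jE c * φ x) (hφi : Function.Injective φ) (hφo : Function.Surjective φ)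
    {γ₂ : GL (Fin 2) E} {lam h : M} (hφγ : ∀ x, φ ((γ₂ : Matrix (Fin 2) (Fin 2) E).mulVec x) = lam * φ x) (hlam : Valued.v lam = 1)
    (hΘh : Θ h = h) (hh : h ≠ 0) (hform : ∀ x y, jE (pairing σ H₂ x y) = h * Θ (φ x) * φ y + ρ (h * Θ (φ x) * φ y))
    (u : E) {b : ℕ} (hb : 1 ≤ b) (hdb : d ≤ b) {j : ℕ} (hlamj : IsOrd ρ α (jE ϖ ^ j) lam)
    (f : ℕ → ℕ → AddSubgroup M → ℕ)
    (hf : ∀ (b j : ℕ) (Λ : AddSubgroup M) (x₀ : M) (r : E), 1 ≤ b → x₀ ≠ 0 →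
      (∀ x, x ∈ Λ ↔ ∃ z, IsOrd ρ α (jE ϖ ^ j) z ∧ x = x₀ * z) →
      IsOrd ρ α (jE ϖ ^ j) (dualGen ρ Θ α (jE ϖ ^ j) h x₀) → ¬ IsOrd ρ α (jE ϖ ^ j) (dualGen ρ Θ α (jE ϖ ^ j) h x₀ / jE ϖ) →
      Valued.v (dualGen ρ Θ α (jE ϖ ^ j) h x₀) = Valued.v (jE ϖ) ^ b →
      (∀ b', (∀ x ∈ Λ, Valued.v (h * Θ x * b' + ρ (h * Θ x * b')) ≤ 1) → (lam - jE u) * b' ∈ Λ) →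
      IsOrd ρ α (jE ϖ ^ j) lam → jE r = glueUnit ρ Θ α (jE ϖ ^ j) h (jE ϖ) (jE hW) x₀ b →
      f b j Λ = Nat.card {x : 𝒪[E] ⧸ 𝓂[E] ^ (2 * b) // ∃ u' : 𝒪[E], Ideal.Quotient.mk (𝓂[E] ^ (2 * b)) u' = x ∧
        Valued.v ((u' : E) * σ u' - r) ≤ Valued.v (ϖ ^ (2 * b))})
    -- the cell letters
    (hjiso : ∀ a, Valued.v (jE a) = Valued.v a)
    (hcell : levelSetDep ρ Θ α (jE ϖ) h j b (lam - jE u) = levelSet ρ Θ α (jE ϖ) h j b) (hfin : (levelSet ρ Θ α (jE ϖ) h j b).Finite)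
    -- the fibration letters of ★ p863197 §1, in the consumer's currency
    (CLS : M → Prop) (Vf : M → M) (ε : Prop) (r : ℤᵐ⁰)
    (Rd : Finset E) (hRd2 : ∀ V : E, σ V = V → Valued.v V ≤ 1 → ∃ V₀ ∈ Rd, Valued.v (V - V₀) ≤ r)
    (hRd3 : ∀ V ∈ Rd, ∀ V' ∈ Rd, Valued.v (V - V') ≤ r → V = V')
    (LIT NX ψ : E → Prop) [DecidablePred LIT] [DecidablePred NX] [DecidablePred ψ]
    (hI : ∀ (Λ : AddSubgroup M) (x₀ x₀' : M), (x₀ ≠ 0 ∧ (∀ x, x ∈ Λ ↔ ∃ ζ, IsOrd ρ α (jE ϖ ^ j) ζ ∧ x = x₀ * ζ) ∧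
        IsOrd ρ α (jE ϖ ^ j) (dualGen ρ Θ α (jE ϖ ^ j) h x₀) ∧ ¬ IsOrd ρ α (jE ϖ ^ j) (dualGen ρ Θ α (jE ϖ ^ j) h x₀ / jE ϖ) ∧
        Valued.v (dualGen ρ Θ α (jE ϖ ^ j) h x₀) = Valued.v (jE ϖ) ^ b) → (x₀' ≠ 0 ∧ (∀ x, x ∈ Λ ↔ ∃ ζ, IsOrd ρ α (jE ϖ ^ j) ζ ∧ x = x₀' * ζ) ∧
        IsOrd ρ α (jE ϖ ^ j) (dualGen ρ Θ α (jE ϖ ^ j) h x₀') ∧ ¬ IsOrd ρ α (jE ϖ ^ j) (dualGen ρ Θ α (jE ϖ ^ j) h x₀' / jE ϖ) ∧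
        Valued.v (dualGen ρ Θ α (jE ϖ ^ j) h x₀') = Valued.v (jE ϖ) ^ b) → (CLS x₀ ↔ CLS x₀') ∧ Valued.v (Vf x₀' - Vf x₀) ≤ r)
    (hV : ∀ (Λ : AddSubgroup M) (x₀ : M), (x₀ ≠ 0 ∧ (∀ x, x ∈ Λ ↔ ∃ ζ, IsOrd ρ α (jE ϖ ^ j) ζ ∧ x = x₀ * ζ) ∧
        IsOrd ρ α (jE ϖ ^ j) (dualGen ρ Θ α (jE ϖ ^ j) h x₀) ∧ ¬ IsOrd ρ α (jE ϖ ^ j) (dualGen ρ Θ α (jE ϖ ^ j) h x₀ / jE ϖ) ∧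
        Valued.v (dualGen ρ Θ α (jE ϖ ^ j) h x₀) = Valued.v (jE ϖ) ^ b) → ∃ Ve : E, jE Ve = Vf x₀ ∧ σ Ve = Ve ∧ Valued.v Ve ≤ 1)
    (hLit : ∀ (Λ : AddSubgroup M) (x₀ : M) (V₀ : E), (x₀ ≠ 0 ∧ (∀ x, x ∈ Λ ↔ ∃ ζ, IsOrd ρ α (jE ϖ ^ j) ζ ∧ x = x₀ * ζ) ∧
        IsOrd ρ α (jE ϖ ^ j) (dualGen ρ Θ α (jE ϖ ^ j) h x₀) ∧ ¬ IsOrd ρ α (jE ϖ ^ j) (dualGen ρ Θ α (jE ϖ ^ j) h x₀ / jE ϖ) ∧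
        Valued.v (dualGen ρ Θ α (jE ϖ ^ j) h x₀) = Valued.v (jE ϖ) ^ b) → V₀ ∈ Rd → Valued.v (Vf x₀ - jE V₀) ≤ r → LIT V₀)
    (hNX : ∀ Ve V₀ : E, σ Ve = Ve → Valued.v Ve ≤ 1 → V₀ ∈ Rd → Valued.v (Ve - V₀) ≤ r → (NX Ve ↔ NX V₀))
    (hψ : ∀ Ve V₀ : E, σ Ve = Ve → Valued.v Ve ≤ 1 → V₀ ∈ Rd → Valued.v (Ve - V₀) ≤ r → (ψ Ve ↔ ψ V₀))
    (hF : ∀ y ∈ Rd.filter LIT, ∀ y' ∈ Rd.filter LIT,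
      {Λ : AddSubgroup M | ∃ x₀, (x₀ ≠ 0 ∧ (∀ x, x ∈ Λ ↔ ∃ ζ, IsOrd ρ α (jE ϖ ^ j) ζ ∧ x = x₀ * ζ) ∧
        IsOrd ρ α (jE ϖ ^ j) (dualGen ρ Θ α (jE ϖ ^ j) h x₀) ∧ ¬ IsOrd ρ α (jE ϖ ^ j) (dualGen ρ Θ α (jE ϖ ^ j) h x₀ / jE ϖ) ∧
        Valued.v (dualGen ρ Θ α (jE ϖ ^ j) h x₀) = Valued.v (jE ϖ) ^ b) ∧ (CLS x₀ ↔ ε) ∧ Valued.v (Vf x₀ - jE y) ≤ r}.ncard =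
        {Λ : AddSubgroup M | ∃ x₀, (x₀ ≠ 0 ∧ (∀ x, x ∈ Λ ↔ ∃ ζ, IsOrd ρ α (jE ϖ ^ j) ζ ∧ x = x₀ * ζ) ∧
        IsOrd ρ α (jE ϖ ^ j) (dualGen ρ Θ α (jE ϖ ^ j) h x₀) ∧ ¬ IsOrd ρ α (jE ϖ ^ j) (dualGen ρ Θ α (jE ϖ ^ j) h x₀ / jE ϖ) ∧
        Valued.v (dualGen ρ Θ α (jE ϖ ^ j) h x₀) = Valued.v (jE ϖ) ^ b) ∧ (CLS x₀ ↔ ε) ∧ Valued.v (Vf x₀ - jE y') ≤ r}.ncard)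
    (hbase : (((Rd.filter LIT).filter NX).filter ψ).card = (((Rd.filter LIT).filter NX).filter fun V => ¬ ψ V).card)
    -- the cell predicates and the three reads
    (P₁ Q₁ : AddSubgroup M → Prop)
    (hP : ∀ (Λ : AddSubgroup M) (x₀ : M), (x₀ ≠ 0 ∧ (∀ x, x ∈ Λ ↔ ∃ ζ, IsOrd ρ α (jE ϖ ^ j) ζ ∧ x = x₀ * ζ) ∧
        IsOrd ρ α (jE ϖ ^ j) (dualGen ρ Θ α (jE ϖ ^ j) h x₀) ∧ ¬ IsOrd ρ α (jE ϖ ^ j) (dualGen ρ Θ α (jE ϖ ^ j) h x₀ / jE ϖ) ∧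
        Valued.v (dualGen ρ Θ α (jE ϖ ^ j) h x₀) = Valued.v (jE ϖ) ^ b) → (f b j Λ ≠ 0 ↔ (CLS x₀ ↔ ε)))
    (hL₁ : ∀ (Λ : AddSubgroup M) (x₀ : M), (x₀ ≠ 0 ∧ (∀ x, x ∈ Λ ↔ ∃ ζ, IsOrd ρ α (jE ϖ ^ j) ζ ∧ x = x₀ * ζ) ∧
        IsOrd ρ α (jE ϖ ^ j) (dualGen ρ Θ α (jE ϖ ^ j) h x₀) ∧ ¬ IsOrd ρ α (jE ϖ ^ j) (dualGen ρ Θ α (jE ϖ ^ j) h x₀ / jE ϖ) ∧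
        Valued.v (dualGen ρ Θ α (jE ϖ ^ j) h x₀) = Valued.v (jE ϖ) ^ b) → f b j Λ ≠ 0 → (P₁ Λ ↔ ∃ Ve : E, jE Ve = Vf x₀ ∧ NX Ve ∧ ψ Ve))
    (hL₂ : ∀ (Λ : AddSubgroup M) (x₀ : M), (x₀ ≠ 0 ∧ (∀ x, x ∈ Λ ↔ ∃ ζ, IsOrd ρ α (jE ϖ ^ j) ζ ∧ x = x₀ * ζ) ∧
        IsOrd ρ α (jE ϖ ^ j) (dualGen ρ Θ α (jE ϖ ^ j) h x₀) ∧ ¬ IsOrd ρ α (jE ϖ ^ j) (dualGen ρ Θ α (jE ϖ ^ j) h x₀ / jE ϖ) ∧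
        Valued.v (dualGen ρ Θ α (jE ϖ ^ j) h x₀) = Valued.v (jE ϖ) ^ b) → f b j Λ ≠ 0 → (Q₁ Λ ↔ ∃ Ve : E, jE Ve = Vf x₀ ∧ NX Ve ∧ ¬ ψ Ve)) :
    ((∑ᶠ Λ ∈ levelSetDep ρ Θ α (jE ϖ) h j b (lam - jE u) ∩ {Λ | P₁ Λ}, f b j Λ : ℕ) : ℤ) -
      ((∑ᶠ Λ ∈ levelSetDep ρ Θ α (jE ϖ) h j b (lam - jE u) ∩ {Λ | Q₁ Λ}, f b j Λ : ℕ) : ℤ) = 0 := by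
  rw [sub_eq_zero, Nat.cast_inj]
  refine (finsum_levelSetDep_inter_weight_eq_iff_of_le σ hσ hvσ hϖ hD h2v hH₂σ hhW hhWσ jE hρρ hvρ hα hα1 hint hΘΘ hΘρ hvΘ hΘj hjv hjfix hjpow hϖmax
    φ hφs hφi hφo hφγ hlam hΘh hh hform u hb hdb hlamj f hf P₁ Q₁).2 ?_
  -- the two populated labelled parts are ★ p863197's sets
  have hsep : ∀ (P : AddSubgroup M → Prop) (φ' : E → Prop),
      (∀ (Λ : AddSubgroup M) (x₀ : M), (x₀ ≠ 0 ∧ (∀ x, x ∈ Λ ↔ ∃ ζ, IsOrd ρ α (jE ϖ ^ j) ζ ∧ x = x₀ * ζ) ∧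
        IsOrd ρ α (jE ϖ ^ j) (dualGen ρ Θ α (jE ϖ ^ j) h x₀) ∧ ¬ IsOrd ρ α (jE ϖ ^ j) (dualGen ρ Θ α (jE ϖ ^ j) h x₀ / jE ϖ) ∧
        Valued.v (dualGen ρ Θ α (jE ϖ ^ j) h x₀) = Valued.v (jE ϖ) ^ b) → f b j Λ ≠ 0 → (P Λ ↔ ∃ Ve : E, jE Ve = Vf x₀ ∧ φ' Ve)) →
      {Λ ∈ levelSetDep ρ Θ α (jE ϖ) h j b (lam - jE u) | P Λ ∧ f b j Λ ≠ 0} =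
        {Λ : AddSubgroup M | ∃ x₀ : M, (x₀ ≠ 0 ∧ (∀ x, x ∈ Λ ↔ ∃ ζ, IsOrd ρ α (jE ϖ ^ j) ζ ∧ x = x₀ * ζ) ∧
        IsOrd ρ α (jE ϖ ^ j) (dualGen ρ Θ α (jE ϖ ^ j) h x₀) ∧ ¬ IsOrd ρ α (jE ϖ ^ j) (dualGen ρ Θ α (jE ϖ ^ j) h x₀ / jE ϖ) ∧
        Valued.v (dualGen ρ Θ α (jE ϖ ^ j) h x₀) = Valued.v (jE ϖ) ^ b) ∧ (CLS x₀ ↔ ε) ∧ ∃ Ve : E, jE Ve = Vf x₀ ∧ φ' Ve} := by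
    intro P φ' hL
    rw [hcell]
    ext Λ
    rw [Set.mem_sep_iff, mem_levelSet_iff, Set.mem_setOf_eq]
    constructor
    · rintro ⟨⟨x₀, hG⟩, hPΛ, hw⟩
      exact ⟨x₀, hG, (hP Λ x₀ hG).1 hw, (hL Λ x₀ hG hw).1 hPΛ⟩
    · rintro ⟨x₀, hG, hC, hVe⟩
      have hw : f b j Λ ≠ 0 := (hP Λ x₀ hG).2 hC
      exact ⟨⟨x₀, hG⟩, (hL Λ x₀ hG hw).2 hVe, hw⟩
  rw [hsep P₁ (fun V => NX V ∧ ψ V) hL₁, hsep Q₁ (fun V => NX V ∧ ¬ ψ V) hL₂]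
  have hbase' : ((Rd.filter LIT).filter fun V => NX V ∧ ψ V).card = ((Rd.filter LIT).filter fun V => NX V ∧ ¬ ψ V).card := by
    rw [← Finset.filter_filter, ← Finset.filter_filter]; exact hbase
  exact ncard_eq_ncard_of_digit_fibration₂ (X := AddSubgroup M)
    (fun (Λ : AddSubgroup M) (x₀ : M) => (x₀ ≠ 0 ∧ (∀ x, x ∈ Λ ↔ ∃ ζ, IsOrd ρ α (jE ϖ ^ j) ζ ∧ x = x₀ * ζ) ∧
        IsOrd ρ α (jE ϖ ^ j) (dualGen ρ Θ α (jE ϖ ^ j) h x₀) ∧ ¬ IsOrd ρ α (jE ϖ ^ j) (dualGen ρ Θ α (jE ϖ ^ j) h x₀ / jE ϖ) ∧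
        Valued.v (dualGen ρ Θ α (jE ϖ ^ j) h x₀) = Valued.v (jE ϖ) ^ b))
    CLS Vf ε jE hjiso r Rd hRd2 hRd3 LIT (fun V => NX V ∧ ψ V) (fun V => NX V ∧ ¬ ψ V) hI hV hLit
    (fun Ve V₀ h1 h2 h3 h4 => and_congr (hNX Ve V₀ h1 h2 h3 h4) (hψ Ve V₀ h1 h2 h3 h4))
    (fun Ve V₀ h1 h2 h3 h4 => and_congr (hNX Ve V₀ h1 h2 h3 h4) (not_congr (hψ Ve V₀ h1 h2 h3 h4))) hF hfin hbase'

end Summit.HodgeConjecture.HodgeConjecture.Cruxes.H413.F0P3cDyRamConeCellCountSocketThree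

end
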